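import Summits.BirchSwinnertonDyer.BirchSwinnertonDyer.Theorems.CyclotomicUntwistDescendedFrobeniusVerschiebungTransfer
import HarnessLib

/-!
# Route `CyclotomicUntwist`: the Berthelot–Ogus transfer is SURJECTIVE — every class `f` of Katz's module `D(Ê/𝓞)_ℚ`
# of a good model `E ≡ V₀ (mod ϖ)` over `𝓞 = 𝓞_{ℚ₃(ζ₉)}` satisfies `g(z⁹) ≡ −9·f` for the class `g = f ∘ ν` of
# `D(V̂₀ ⊗ 𝓞/𝓞)_ℚ`

Cell `pub/bsd-wall` (D-0145 line `route-BirchSwinnertonDyer-CyclotomicUntwist`), prover seat `bsd-line-cycu-p2`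
(gen 6), lane «D5»; sequel of `…VerschiebungTransfer` (`f ∘ ν ∈ D(V̂₀ ⊗ 𝓞/𝓞)_ℚ`) and `…Verschiebung`
(`[−9]_E ≡ ν(z⁹) (mod 3)`). THEOREMS ONLY (no definition, no named fact, no `sorry`); helper `--supports` K1 =
stmt-BirchSwinnertonDyer-21580. BSD is not proved by this file and no crux is.

* `isIntegral_coeff_subst_formalNeg_add`: `f(i(w)) + f(w) ≡ 0` (`w = [9]z`; `Ĝ(w, i w) = 0`).
* `isIntegral_coeff_subst_formalMul_sub`: `f([m]z) ≡ m·f(z)`.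
* **`isIntegral_coeff_expand_verschiebung_add`**: `(f∘ν)(z⁹) + 9·f ≡ 0` modulo `3^{−B}𝓞⟦z⟧`
  (`ν(z⁹) ≡ [−9]z (mod 3)` + Key Lemma, then the two congruences above).
* **`exists_transfer_preimage`**: for every `E ≡ V₀ ⊗ 𝓞 (mod ϖ)`, `3 ∣ ϖ⁶`, and every class `f` of `D(Ê/𝓞)_ℚ`
  (exponent `B`) there is a class `g` of `D(V̂₀ ⊗ 𝓞/𝓞)_ℚ` (exponent `B`) with `g(z⁹) + 9f ≡ 0 (mod 3^{−B}𝓞⟦z⟧)`: the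
  transfer `g ↦ [g(z⁹)]` of `…TransferSemantics.transfer_coboundary_integral` (well defined on such `g` by the same
  Key-Lemma argument) is SURJECTIVE onto `D(Ê/𝓞)_ℚ` — Berthelot–Ogus (2.4) in Katz's explicit language: the relative
  Frobenius power `z⁹` is inverted, up to `[9]`, by the Verschiebung lift.
* `formalGroupLaw_map_ONine_eq_map_padic`: currency bridge (`G₀` read over `L` through `𝓞` or through `ℚ₃`).
What this does NOT do: the rank statement `D(V̂₀ ⊗ 𝓞/𝓞)_ℚ = L·log₀ + L·log₀(z³) + (bounded)` (Dieudonné theory of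
the height-2 `ℤ₃`-group: Katz §5.3 via Mazur–Messing, or Honda) and the second-kind property of `η = ∫(xω − dz/z²)`
(universally integral coboundary — checked by machine through total degree 15, compute job j307804) are not proved
here; with them `isDescendedFrobeniusMatrix_exists` follows via `isDescendedFrobeniusMatrix_exists_of_transfer`.
[cite: BerthelotOgus1983, Thm. 2.4 (proof)] [cite: Katz1981CrystallineDieudonne, §5 Lemma 5.1.1, Thm 5.1.4]
-/

set_option autoImplicit false
-- single-conjunct summit: `Summit.BirchSwinnertonDyer.BirchSwinnertonDyer.…` repeats the name by design
set_option linter.dupNamespace false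

noncomputable section

open PowerSeries Literature.RingTheory.FormalGroups Literature.NumberTheory.EllipticCurves
  Literature.NumberTheory.EllipticCurves.DescendedFrobenius

namespace Summit.BirchSwinnertonDyer.BirchSwinnertonDyer.Theorems.DescendedFrobeniusTransfer

/-! ## §1 `(f ∘ ν)(z⁹) ≡ −9·f` -/

/-- `f(Ĝ(t₀, t₁)) − f(t₀) − f(t₁) = (∂_Ĝ f)(t₀, t₁)` for one-variable `𝓞`-series `t₀, t₁` read in `L`. [folklore] -/
theorem mvSubst_coboundary_pair (E : WeierstrassCurve ONine) (f : KNine⟦X⟧) {t : Fin 2 → ONine⟦X⟧}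
    (ht : ∀ i, PowerSeries.constantCoeff (t i) = 0) :
    MvPowerSeries.subst (fun i ↦ (MvPowerSeries.map (algebraMap ONine KNine) (t i) : MvPowerSeries Unit KNine))
      (f.subst (E.map (algebraMap ONine KNine)).formalGroupLaw -
        f.subst (MvPowerSeries.X 0 : MvPowerSeries (Fin 2) KNine) -
        f.subst (MvPowerSeries.X 1 : MvPowerSeries (Fin 2) KNine)) =
      f.subst (MvPowerSeries.subst (fun i ↦ (MvPowerSeries.map (algebraMap ONine KNine) (t i) : MvPowerSeries Unit KNine))
        (E.map (algebraMap ONine KNine)).formalGroupLaw) -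
      f.subst (PowerSeries.map (algebraMap ONine KNine) (t 0)) - f.subst (PowerSeries.map (algebraMap ONine KNine) (t 1)) := by
  have hsK : MvPowerSeries.HasSubst
      (fun i ↦ (MvPowerSeries.map (algebraMap ONine KNine) (t i) : MvPowerSeries Unit KNine)) :=
    MvPowerSeries.hasSubst_of_constantCoeff_zero fun i ↦ by
      rw [MvPowerSeries.constantCoeff_map]
      change algebraMap ONine KNine (PowerSeries.constantCoeff (t i)) = 0
      rw [ht i, map_zero]
  have hGKs : PowerSeries.HasSubst (E.map (algebraMap ONine KNine)).formalGroupLaw :=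
    PowerSeries.HasSubst.of_constantCoeff_zero (E.map (algebraMap ONine KNine)).constantCoeff_formalGroupLaw
  rw [MvPowerSeries.subst_sub hsK, MvPowerSeries.subst_sub hsK, mvSubst_powerSeries_subst hGKs hsK,
    mvSubst_powerSeries_subst (PowerSeries.HasSubst.X 0) hsK, mvSubst_powerSeries_subst (PowerSeries.HasSubst.X 1) hsK,
    MvPowerSeries.subst_X hsK, MvPowerSeries.subst_X hsK]
  rfl

/-- **`f(i(w)) + f(w) ≡ 0`** for `w = [9]_E z` (read in `L`): `Ĝ(w, i(w)) = 0`, `f(0) = 0`, so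
`f(i w) + f(w) = −(∂_Ĝ f)(w, i w)`. [cite: Katz1981CrystallineDieudonne, §5 Lemma 5.1.1] -/
theorem isIntegral_coeff_subst_formalNeg_add (E : WeierstrassCurve ONine) {f : KNine⟦X⟧} {B : ℕ}
    (hf0 : PowerSeries.constantCoeff f = 0)
    (hfc : ∀ d, IsIntegral ℤ_[3] ((3 : KNine) ^ B * MvPowerSeries.coeff d
      (f.subst (E.map (algebraMap ONine KNine)).formalGroupLaw -
        f.subst (MvPowerSeries.X 0 : MvPowerSeries (Fin 2) KNine) -
        f.subst (MvPowerSeries.X 1 : MvPowerSeries (Fin 2) KNine))))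
    (k : ℕ) :
    IsIntegral ℤ_[3] ((3 : KNine) ^ B * PowerSeries.coeff k
      (f.subst (PowerSeries.map (algebraMap ONine KNine) (E.formalNeg.subst (E.formalMul 9))) +
        f.subst (PowerSeries.map (algebraMap ONine KNine) (E.formalMul 9)))) := by
  set ι := algebraMap ONine KNine with hι
  set EK := E.map ι with hEK
  set t : Fin 2 → ONine⟦X⟧ := ![E.formalMul 9, E.formalNeg.subst (E.formalMul 9)] with htdef
  have ht : ∀ i, PowerSeries.constantCoeff (t i) = 0 := by
    intro i; fin_cases i
    · exact E.constantCoeff_formalMul 9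
    · exact Summit.BirchSwinnertonDyer.BirchSwinnertonDyer.Theorems.RelativeLubinTate.constantCoeff_formalNeg_subst_formalMul' E 9
  -- `Ĝ(w, i w) = 0` with `w = [9]` read in `L`
  have hw : PowerSeries.map ι (E.formalMul 9) = EK.formalMul 9 := WeierstrassCurve.map_formalMul E ι 9
  have hiw : PowerSeries.map ι (E.formalNeg.subst (E.formalMul 9)) = EK.formalNeg.subst (EK.formalMul 9) := by
    rw [WeierstrassCurve.powerSeries_map_subst _ (E.hasSubst_formalMul 9), WeierstrassCurve.map_formalNeg,
      WeierstrassCurve.map_formalMul]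
  have hpair : MvPowerSeries.HasSubst ![(PowerSeries.X : KNine⟦X⟧), EK.formalNeg] :=
    WeierstrassCurve.hasSubst_pair PowerSeries.constantCoeff_X EK.constantCoeff_formalNeg
  have hwS : PowerSeries.HasSubst (EK.formalMul 9) := EK.hasSubst_formalMul 9
  have hfun : (fun i ↦ (MvPowerSeries.map ι (t i) : MvPowerSeries Unit KNine)) =
      fun i ↦ PowerSeries.subst (EK.formalMul 9) (![(PowerSeries.X : KNine⟦X⟧), EK.formalNeg] i) := by
    funext i; fin_cases i
    · change PowerSeries.map ι (E.formalMul 9) = PowerSeries.subst (EK.formalMul 9) PowerSeries.X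
      rw [PowerSeries.subst_X hwS, hw]
    · change PowerSeries.map ι (E.formalNeg.subst (E.formalMul 9)) = EK.formalNeg.subst (EK.formalMul 9)
      exact hiw
  have hzero : MvPowerSeries.subst (fun i ↦ (MvPowerSeries.map ι (t i) : MvPowerSeries Unit KNine)) EK.formalGroupLaw = 0 := by
    rw [hfun]
    change MvPowerSeries.subst (fun i ↦ MvPowerSeries.subst (fun _ : Unit ↦ EK.formalMul 9)
      (![(PowerSeries.X : KNine⟦X⟧), EK.formalNeg] i)) EK.formalGroupLaw = 0
    rw [← MvPowerSeries.subst_comp_subst_apply hpair hwS.const, EK.formalGroupLaw_subst_X_formalNeg',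
      ← MvPowerSeries.coe_substAlgHom hwS.const, map_zero]
  have hcob := mvSubst_coboundary_pair E f ht
  rw [hzero, PowerSeries.subst_zero_of_constantCoeff_zero hf0, zero_sub] at hcob
  -- `f(i w) + f(w) = −(∂f)(w, i w)`
  have key : f.subst (PowerSeries.map ι (E.formalNeg.subst (E.formalMul 9))) + f.subst (PowerSeries.map ι (E.formalMul 9)) =
      -(MvPowerSeries.subst (fun i ↦ (MvPowerSeries.map ι (t i) : MvPowerSeries Unit KNine))
        (f.subst EK.formalGroupLaw - f.subst (MvPowerSeries.X 0 : MvPowerSeries (Fin 2) KNine) -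
          f.subst (MvPowerSeries.X 1 : MvPowerSeries (Fin 2) KNine))) := by
    rw [hcob]
    change _ = -(-f.subst (PowerSeries.map ι (E.formalMul 9)) - f.subst (PowerSeries.map ι (E.formalNeg.subst (E.formalMul 9))))
    ring
  rw [key, map_neg, mul_neg]
  exact (isIntegral_coeff_mvSubst_of_map hfc ht (Finsupp.single () k)).neg

/-- **`f([m] z) ≡ m·f(z)`** modulo `3^{−B}𝓞⟦z⟧` for a class `f` of `D(Ê/𝓞)_ℚ` (`[m+1] = Ĝ(z, [m]z)`, induction).
[cite: Katz1981CrystallineDieudonne, §5 Lemma 5.1.1] -/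
theorem isIntegral_coeff_subst_formalMul_sub (E : WeierstrassCurve ONine) {f : KNine⟦X⟧} {B : ℕ}
    (hf0 : PowerSeries.constantCoeff f = 0)
    (hfc : ∀ d, IsIntegral ℤ_[3] ((3 : KNine) ^ B * MvPowerSeries.coeff d
      (f.subst (E.map (algebraMap ONine KNine)).formalGroupLaw -
        f.subst (MvPowerSeries.X 0 : MvPowerSeries (Fin 2) KNine) -
        f.subst (MvPowerSeries.X 1 : MvPowerSeries (Fin 2) KNine))))
    (m k : ℕ) :
    IsIntegral ℤ_[3] ((3 : KNine) ^ B * PowerSeries.coeff k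
      (f.subst (PowerSeries.map (algebraMap ONine KNine) (E.formalMul m)) - (m : KNine) • f)) := by
  set ι := algebraMap ONine KNine with hι
  set EK := E.map ι with hEK
  induction m generalizing k with
  | zero =>
    rw [WeierstrassCurve.formalMul_zero, map_zero (PowerSeries.map ι), Nat.cast_zero, zero_smul, sub_zero]
    change IsIntegral ℤ_[3] ((3 : KNine) ^ B * PowerSeries.coeff k (f.subst (0 : MvPowerSeries Unit KNine)))
    rw [PowerSeries.subst_zero_of_constantCoeff_zero hf0, map_zero, mul_zero]
    exact isIntegral_zero
  | succ m ih =>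
    set t : Fin 2 → ONine⟦X⟧ := ![PowerSeries.X, E.formalMul m] with htdef
    have ht : ∀ i, PowerSeries.constantCoeff (t i) = 0 := by
      intro i; fin_cases i
      · exact PowerSeries.constantCoeff_X
      · exact E.constantCoeff_formalMul m
    have hfun : (fun i ↦ (MvPowerSeries.map ι (t i) : MvPowerSeries Unit KNine)) =
        ![(PowerSeries.X : KNine⟦X⟧), EK.formalMul m] := by
      funext i; fin_cases i
      · change PowerSeries.map ι PowerSeries.X = PowerSeries.X
        exact PowerSeries.map_X ι
      · change PowerSeries.map ι (E.formalMul m) = EK.formalMul m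
        exact WeierstrassCurve.map_formalMul E ι m
    have hsucc : PowerSeries.map ι (E.formalMul (m + 1)) =
        MvPowerSeries.subst (fun i ↦ (MvPowerSeries.map ι (t i) : MvPowerSeries Unit KNine)) EK.formalGroupLaw := by
      rw [hfun, WeierstrassCurve.map_formalMul, ← EK.formalMul_succ'']
    have hcob := mvSubst_coboundary_pair E f ht
    rw [← hsucc] at hcob
    have key : f.subst (PowerSeries.map ι (E.formalMul (m + 1))) - (((m + 1 : ℕ) : KNine)) • f =
        MvPowerSeries.subst (fun i ↦ (MvPowerSeries.map ι (t i) : MvPowerSeries Unit KNine))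
          (f.subst EK.formalGroupLaw - f.subst (MvPowerSeries.X 0 : MvPowerSeries (Fin 2) KNine) -
            f.subst (MvPowerSeries.X 1 : MvPowerSeries (Fin 2) KNine)) +
        (f.subst (PowerSeries.map ι (E.formalMul m)) - (m : KNine) • f) := by
      rw [hcob]
      change _ = f.subst (PowerSeries.map ι (E.formalMul (m + 1))) - f.subst (PowerSeries.map ι PowerSeries.X) -
        f.subst (PowerSeries.map ι (E.formalMul m)) + _
      rw [PowerSeries.map_X, PowerSeries.X_subst, Nat.cast_succ, add_smul, one_smul]
      ring
    rw [key, map_add, mul_add]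
    exact (isIntegral_coeff_mvSubst_of_map hfc ht (Finsupp.single () k)).add (ih k)

/-- **`(f ∘ ν)(z⁹) + 9·f ≡ 0` modulo `3^{−B}𝓞⟦z⟧`**: `(f∘ν)(z⁹) = f(ν(z⁹)) ≡ f([−9]z)` (Key Lemma, `ν(z⁹) ≡ [−9]z (mod 3)`),
`f([−9]z) = f(i([9]z)) ≡ −f([9]z) ≡ −9·f`. [cite: Katz1981CrystallineDieudonne, §5 Thm 5.1.4]
[cite: BerthelotOgus1983, Thm. 2.4 (proof)] -/
theorem isIntegral_coeff_expand_verschiebung_add {E : WeierstrassCurve ONine} {ν : ONine⟦X⟧}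
    (hν0 : PowerSeries.constantCoeff ν = 0)
    (hν : PowerSeries.map (Ideal.Quotient.mk (Ideal.span {(3 : ONine)})) (E.formalNeg.subst (E.formalMul 9)) =
      PowerSeries.map (Ideal.Quotient.mk (Ideal.span {(3 : ONine)})) (PowerSeries.expand 9 (by norm_num) ν))
    {f : KNine⟦X⟧} {B : ℕ} (hf0 : PowerSeries.constantCoeff f = 0)
    (hfd : ∀ n : ℕ, IsIntegral ℤ_[3] ((3 : KNine) ^ B * ((n : KNine) * PowerSeries.coeff n f)))
    (hfc : ∀ d, IsIntegral ℤ_[3] ((3 : KNine) ^ B * MvPowerSeries.coeff d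
      (f.subst (E.map (algebraMap ONine KNine)).formalGroupLaw -
        f.subst (MvPowerSeries.X 0 : MvPowerSeries (Fin 2) KNine) -
        f.subst (MvPowerSeries.X 1 : MvPowerSeries (Fin 2) KNine))))
    (n : ℕ) :
    IsIntegral ℤ_[3] ((3 : KNine) ^ B * PowerSeries.coeff n
      (PowerSeries.expand 9 (by norm_num) (f.subst (PowerSeries.map (algebraMap ONine KNine) ν)) + (9 : KNine) • f)) := by
  set ι := algebraMap ONine KNine with hι
  set νK := PowerSeries.map ι ν with hνK
  set μ := E.formalNeg.subst (E.formalMul 9) with hμ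
  have hνK0 : PowerSeries.constantCoeff νK = 0 := by
    rw [hνK, ← PowerSeries.coeff_zero_eq_constantCoeff_apply, PowerSeries.coeff_map,
      PowerSeries.coeff_zero_eq_constantCoeff_apply, hν0, map_zero]
  have hνKs : PowerSeries.HasSubst νK := PowerSeries.HasSubst.of_constantCoeff_zero' hνK0
  have hμ0 : PowerSeries.constantCoeff μ = 0 :=
    Summit.BirchSwinnertonDyer.BirchSwinnertonDyer.Theorems.RelativeLubinTate.constantCoeff_formalNeg_subst_formalMul' E 9
  have hU0 : PowerSeries.constantCoeff (PowerSeries.expand 9 (by norm_num) ν) = 0 := by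
    rw [PowerSeries.constantCoeff_expand, hν0]
  -- (1) `(f∘νK)(z⁹) = f((expand 9 ν) read in L)`
  have e1 : PowerSeries.expand 9 (by norm_num) (f.subst νK) = f.subst (PowerSeries.map ι (PowerSeries.expand 9 (by norm_num) ν)) := by
    rw [PowerSeries.expand_apply, PowerSeries.subst_comp_subst_apply hνKs (PowerSeries.HasSubst.X_pow (by norm_num)),
      ← PowerSeries.expand_apply, hνK, PowerSeries.map_expand]
  -- (2) Key Lemma: `expand 9 ν ≡ μ (mod 3)`
  have hUV : MvPowerSeries.C (3 : ONine) ∣ PowerSeries.expand 9 (by norm_num) ν - μ := by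
    rw [C_dvd_iff_forall_dvd_coeff, ← map_mk_eq_map_mk_iff]
    exact hν.symm
  have h2 := isIntegral_mvCoeff_subst_sub_subst_K (σ := Unit) hfd hU0 hμ0 hUV (Finsupp.single () n)
  -- (3)+(4)+(5)
  have h3 := isIntegral_coeff_subst_formalNeg_add E hf0 hfc n
  have h4 := isIntegral_coeff_subst_formalMul_sub E hf0 hfc 9 n
  have key : PowerSeries.expand 9 (by norm_num) (f.subst νK) + (9 : KNine) • f =
      (f.subst (PowerSeries.map ι (PowerSeries.expand 9 (by norm_num) ν)) - f.subst (PowerSeries.map ι μ)) +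
      (f.subst (PowerSeries.map ι μ) + f.subst (PowerSeries.map ι (E.formalMul 9))) -
      (f.subst (PowerSeries.map ι (E.formalMul 9)) - ((9 : ℕ) : KNine) • f) := by
    rw [e1, Nat.cast_ofNat]; ring
  rw [key, map_sub, map_add, mul_sub, mul_add]
  exact (h2.add h3).sub h4

/-! ## §2 The transfer is surjective -/

/-- **BERTHELOT–OGUS SURJECTIVITY IN POWER SERIES.** Let `E/𝓞` be congruent modulo `ϖ` (`3 ∣ ϖ⁶`) to the `ℤ₃`-curve
`V₀`, and let `f ∈ L⟦z⟧`, `f(0) = 0`, be a class of `D(Ê/𝓞)_ℚ` with exponent `B` (`3ᴮ n [zⁿ]f ∈ 𝓞`,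
`3ᴮ ∂_Ĝ f ∈ 𝓞⟦X,Y⟧`). Then there is `g ∈ L⟦z⟧` — namely `f ∘ ν` — which is a class of `D(V̂₀ ⊗ 𝓞/𝓞)_ℚ` with the same
exponent AND `g(z⁹) + 9·f ≡ 0 (mod 3^{−B}𝓞⟦z⟧)`: the transfer `g ↦ [g(z⁹)]` of `transfer_coboundary_integral` hits
`[f] = −(1/9)[g(z⁹)]`. [cite: BerthelotOgus1983, Thm. 2.4 (proof)] [cite: Katz1981CrystallineDieudonne, §5 Thm 5.1.4] -/
theorem exists_transfer_preimage {ϖ : ONine} (hϖ : (3 : ONine) ∣ ϖ ^ 6) {E : WeierstrassCurve ONine}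
    {V₀ : WeierstrassCurve ℤ_[3]}
    (hEV : E.map (Ideal.Quotient.mk (Ideal.span {ϖ})) =
      (V₀.map (algebraMap ℤ_[3] ONine)).map (Ideal.Quotient.mk (Ideal.span {ϖ})))
    {f : KNine⟦X⟧} {B : ℕ} (hf0 : PowerSeries.constantCoeff f = 0)
    (hfd : ∀ n : ℕ, IsIntegral ℤ_[3] ((3 : KNine) ^ B * ((n : KNine) * PowerSeries.coeff n f)))
    (hfc : ∀ d, IsIntegral ℤ_[3] ((3 : KNine) ^ B * MvPowerSeries.coeff d
      (f.subst (E.map (algebraMap ONine KNine)).formalGroupLaw -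
        f.subst (MvPowerSeries.X 0 : MvPowerSeries (Fin 2) KNine) -
        f.subst (MvPowerSeries.X 1 : MvPowerSeries (Fin 2) KNine)))) :
    ∃ g : KNine⟦X⟧,
      (∀ n : ℕ, IsIntegral ℤ_[3] ((3 : KNine) ^ B * ((n : KNine) * PowerSeries.coeff n g))) ∧
      (∀ d, IsIntegral ℤ_[3] ((3 : KNine) ^ B * MvPowerSeries.coeff d
        (g.subst (((V₀.map (algebraMap ℤ_[3] ONine)).formalGroupLaw).map (algebraMap ONine KNine)) -
          g.subst (MvPowerSeries.X 0 : MvPowerSeries (Fin 2) KNine) -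
          g.subst (MvPowerSeries.X 1 : MvPowerSeries (Fin 2) KNine)))) ∧
      ∀ n : ℕ, IsIntegral ℤ_[3] ((3 : KNine) ^ B * PowerSeries.coeff n
        (PowerSeries.expand 9 (by norm_num) g + (9 : KNine) • f)) := by
  obtain ⟨ν, hν0, hν⟩ := exists_verschiebung_lift E
  exact ⟨_, isIntegral_natCast_mul_coeff_subst_verschiebung hfd hν0,
    isIntegral_coeff_coboundary_verschiebung hϖ hEV hν0 hν hfd hfc,
    isIntegral_coeff_expand_verschiebung_add hν0 hν hf0 hfd hfc⟩

/-- The `ℤ₃`-lift's group law read over `L` two ways: through `𝓞` or through `ℚ₃` (currency bridge to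
`transfer_coboundary_integral`, whose coboundaries are over `ℚ₃`). [folklore] -/
theorem formalGroupLaw_map_ONine_eq_map_padic (V₀ : WeierstrassCurve ℤ_[3]) :
    ((V₀.map (algebraMap ℤ_[3] ONine)).formalGroupLaw).map (algebraMap ONine KNine) =
      ((V₀.map PadicInt.Coe.ringHom).formalGroupLaw).map (algebraMap ℚ_[3] KNine) := by
  have hcomp : (algebraMap ONine KNine).comp (algebraMap ℤ_[3] ONine) =
      (algebraMap ℚ_[3] KNine).comp (PadicInt.Coe.ringHom (p := 3)) := by
    ext x
    rw [RingHom.comp_apply, RingHom.comp_apply, ← IsScalarTower.algebraMap_apply ℤ_[3] ONine KNine x,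
      IsScalarTower.algebraMap_apply ℤ_[3] ℚ_[3] KNine x]
    rfl
  rw [← WeierstrassCurve.map_formalGroupLaw, ← WeierstrassCurve.map_formalGroupLaw, MvPowerSeries.map_map,
    MvPowerSeries.map_map, hcomp]

end Summit.BirchSwinnertonDyer.BirchSwinnertonDyer.Theorems.DescendedFrobeniusTransfer
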